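import Summits.BirchSwinnertonDyer.BirchSwinnertonDyer.Theorems.ResidualThetaTransportAtTwoThetaLayerLambdaCongruenceAtTwoCuspSpanConjugation
import Summits.BirchSwinnertonDyer.BirchSwinnertonDyer.Theorems.ResidualThetaTransportAtTwoThetaLayerLambdaCongruenceAtTwoCuspSpanArtinArith
import Summits.BirchSwinnertonDyer.BirchSwinnertonDyer.Theorems.ResidualThetaTransportAtTwoArtinDefs
import Summits.BirchSwinnertonDyer.BirchSwinnertonDyer.Theorems.ResidualThetaTransportAtTwoThetaLayerLambdaCongruenceAtTwoCuspSpanArtinWitness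
import Summits.BirchSwinnertonDyer.BirchSwinnertonDyer.Theorems.ResidualThetaTransportAtTwoSignedMuVanishingAtTwoPlusCuspSpanNamed
import Summits.BirchSwinnertonDyer.BirchSwinnertonDyer.Theorems.ResidualThetaTransportAtTwoThetaLayerLambdaCongruenceAtTwoOfSignedMuAnalytic
import HarnessLib

/-!
# Route `ResidualThetaTransportAtTwo`, crux Kan⁺ `ThetaLayerLambdaCongruenceAtTwo` (stmt-BirchSwinnertonDyer-20688) / Kμ⁺ / 21437:
# THE NODE (G′)_N = `CuspSpanEvenAtTwo N` AT EVERY ODD LEVEL `N` UNDER THE NAMED HYPOTHESIS `ArtinPrimitiveRootTwoAP`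
# (Artin's conjecture for the base `2` in progressions `≡ 3 (mod 8)`, a theorem under GRH — Lenstra 1977), SECOND KERNEL ROUTE,
# and the closers BY NAME: FLAT on the habitat⁺, the item 21437 (mod Abbes–Ullmo), the crux Kan⁺ (mod PUB⁷ + Abbes–Ullmo)

Cell `bsd-wall`, width seat `bsd-wall-rtt-p3-w4` (g0). THEOREMS ONLY; `--supports stmt-BirchSwinnertonDyer-20688`; BSD is not proved by this,
and nothing conjecture-grade is asserted: the Artin hypothesis is the explicit binder `hA : ArtinPrimitiveRootTwoAP` (`…ArtinDefs`, p629022).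
RELATION TO `…CuspSpanArtinReduction` (width seat w5, p630531, landed first, same day): that file proves the same implication with the
hypothesis spelled inline ((AP₃), `φ(N)`-bookkeeping). This file is an INDEPENDENT second kernel route (`ord_N 4`-bookkeeping, unit lifting
`(ℤ/|c|M)^× ↠ (ℤ/|c|)^×` instead of a coprime shift, three pre-moves `T^{i₀} L_{t₀} T^{i}`; arithmetic in `…CuspSpanArtinTools` p628953 /
`…CuspSpanArtinArith` p629855) stated with the NAMED hypothesis, plus the class-wide closers by name that `…ArtinReduction` does not state
(`flatMuZeroAtTwo_of_artinAP`, `signedMuAnalyticAtTwoPlus_of_abbesUllmo_of_artinAP`, `thetaLayerLambdaCongruenceAtTwo_of_pub_of_abbesUllmo_of_artinAP`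
through the lead's PUB⁸ twin closer). Two independent formal routes to a claim this strong (GRH ⟹ the node ⟹ `μ⁻ = 0` at `2` on the
habitat⁺, modulo print) is the point; the statements are not restated verbatim.

* §1 `chi_eq_zero_of_col_dvd_mul_four_pow_mul_four_pow` — COLUMN FORM of the conjugation criterion (`chi_eq_zero_of_conj_witness`, p626263):
  `γ = (a b; c d) ∈ Γ₀(N)` is killed as soon as `(c + t N a) ∣ a·4^k − 1` for some `t`, `k ≥ 1`; `exists_left_T` / `exists_left_L` — the
  parabolic pre-moves `(a, c) ↦ (a + i c, c)`, `(a, c) ↦ (a, c + t N a)` do not change `χ`.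
* §2 `chi_eq_zero_of_mem_gamma1_of_artinAPAP` — with `CuspSpanArtin.exists_column_kill`: under `ArtinPrimitiveRootTwoAP`, at every odd `N`
  every admissible `χ` kills `Γ₁'(N)`; then w5's hook `exists_mulChar_of_forall_gamma1` gives (G″)_N (`cuspSpanTrace_of_artinAPAP`) and
  **`cuspSpanEvenAtTwo_of_artinAP : ArtinPrimitiveRootTwoAP → ¬ 2 ∣ N → CuspSpanEvenAtTwo N`**, `forall_cuspSpanEvenAtTwo_of_artinAPAP`.
* §3 closers by name (conditional; nothing is closed): `flatMuZeroAtTwo_of_artinAP` (the registered stub text of Kμ⁺ 20689, verbatim, under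
  ONE classical hypothesis), `signedMuAnalyticAtTwoPlus_of_abbesUllmo_of_artinAP` (item 21437),
  `thetaLayerLambdaCongruenceAtTwo_of_pub_of_abbesUllmo_of_artinAP` (the crux Kan⁺ from the seven print facts, Abbes–Ullmo and Artin, via
  `ThetaLayerLambdaCongruenceAtTwo.kanP_of_pub_of_signedMuAnalyticAtTwoPlus`, p612933).

Remark (for the lead): the per-`γ` statement (W_N) of `cuspSpanTrace_of_gamma1_conj_witness` is unsatisfiable as typed at `N = 7`
(`γ = (29 2; 14 1)`: a witness forces `(29/|2+29t|) = +1`, but it equals `(±2/29) = −1`); the pre-moves of §1 are what repair it.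
References: [Moree2012ArtinSurvey] Thms. 1–2; [Lenstra1977Artin] Thm. 8.3; [Rademacher1929] §1; [Pollack2003] Conj. 6.3; [AbbesUllmo1996] Thm. A.
-/

set_option autoImplicit false
set_option linter.dupNamespace false

noncomputable section

open scoped Classical MatrixGroups ModularForm

open CongruenceSubgroup WeierstrassCurve Literature.NumberTheory.EllipticCurves
  Literature.NumberTheory.EllipticCurves.ModularForms Literature.NumberTheory.EllipticCurves.Rank1Residual
  Literature.NumberTheory.IwasawaTheory Summit.BirchSwinnertonDyer.Rank1Residual.Supersingular
  Summit.BirchSwinnertonDyer.BirchSwinnertonDyer.Theses.ResidualThetaTransportAtTwo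

namespace Summit.BirchSwinnertonDyer.BirchSwinnertonDyer.Theorems.SignedMuAtTwo

variable {N : ℕ} {χ : Gamma0 N → ZMod 2}

/-! ## §1. Column form of the conjugation criterion; parabolic pre-moves -/

/-- **Column form.** For additive `χ` killing the small-trace elements and the `4^k`-classes and `γ = (a b; c d) ∈ Γ₀(N)`:
if `(c + tNa) ∣ a·4^k − 1` (`k ≥ 1`) then `χ γ = 0` — since `a(d + tNb) − b(c + tNa) = 1`, the number `c + tNa` also divides
`4^k − d − tNb`, which is the witness of `chi_eq_zero_of_conj_witness` with `ε = 1`. [cite: Rademacher1929, §1] -/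
theorem chi_eq_zero_of_col_dvd_mul_four_pow
    (hadd : ∀ γ δ : Gamma0 N, χ (γ * δ) = χ γ + χ δ)
    (hsmall : ∀ γ : Gamma0 N, ((γ : SL(2, ℤ)) 0 0 + (γ : SL(2, ℤ)) 1 1).natAbs ≤ 2 → χ γ = 0)
    (hkill : ∀ γ : Gamma0 N, (∃ k : ℕ, 1 ≤ k ∧ ((γ : SL(2, ℤ)) 1 1).natAbs = 4 ^ k) → χ γ = 0)
    (γ : Gamma0 N) (t : ℤ) (k : ℕ) (hk : 1 ≤ k)
    (h : ((γ : SL(2, ℤ)) 1 0 + t * N * (γ : SL(2, ℤ)) 0 0) ∣ ((γ : SL(2, ℤ)) 0 0 * 4 ^ k - 1)) :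
    χ γ = 0 := by
  set a := (γ : SL(2, ℤ)) 0 0 with ha
  set b := (γ : SL(2, ℤ)) 0 1 with hb
  set c := (γ : SL(2, ℤ)) 1 0 with hc
  set d := (γ : SL(2, ℤ)) 1 1 with hd
  have hdet : a * d - b * c = 1 := by
    have := Matrix.SpecialLinearGroup.det_coe (γ : SL(2, ℤ))
    rwa [Matrix.det_fin_two] at this
  set g := c + t * N * a with hg
  obtain ⟨e, he⟩ := h
  have hcop : IsCoprime g a := ⟨-b, d + t * N * b, by rw [hg]; linear_combination hdet⟩
  have hdvd : g ∣ (4 ^ k - d - t * N * b) * a := by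
    refine ⟨e - b, ?_⟩
    have : a * 4 ^ k = 1 + g * e := by linear_combination he
    linear_combination this - hdet
  obtain ⟨m, hm⟩ := hcop.dvd_of_dvd_mul_right hdvd
  refine chi_eq_zero_of_conj_witness hadd hsmall hkill γ t m k hk 1 rfl ?_
  rw [← ha, ← hb, ← hc, ← hd, ← hg, one_mul]
  linear_combination -hm

/-- **Pre-move `T^i` on the left**: `(a, c) ↦ (a + ic, c)` without changing `χ` (`χ(T^i) = 0`, trace `2`). [folklore] -/
theorem exists_left_T (hadd : ∀ γ δ : Gamma0 N, χ (γ * δ) = χ γ + χ δ)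
    (hsmall : ∀ γ : Gamma0 N, ((γ : SL(2, ℤ)) 0 0 + (γ : SL(2, ℤ)) 1 1).natAbs ≤ 2 → χ γ = 0)
    (γ : Gamma0 N) (i : ℤ) :
    ∃ γ' : Gamma0 N, (γ' : SL(2, ℤ)) 0 0 = (γ : SL(2, ℤ)) 0 0 + i * (γ : SL(2, ℤ)) 1 0 ∧
      (γ' : SL(2, ℤ)) 1 0 = (γ : SL(2, ℤ)) 1 0 ∧ χ γ' = χ γ := by
  obtain ⟨T, hT00, hT01, hT10, hT11⟩ :=
    ThetaLayerLambdaCongruenceAtTwo.exists_gamma0_entries (N := N) 1 i 0 1 (by ring) (dvd_zero _)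
  refine ⟨T * γ, ?_, ?_, ?_⟩
  · rw [gamma0_mul_apply_zero_zero', hT00, hT01]; ring
  · rw [ThetaLayerLambdaCongruenceAtTwo.gamma0_mul_apply_one_zero, hT10, hT11]; ring
  · rw [hadd, hsmall T (by rw [hT00, hT11]; rfl), zero_add]

/-- **Pre-move `L_t` on the left**: `(a, c) ↦ (a, c + tNa)` without changing `χ` (`χ(L_t) = 0`, trace `2`). [folklore] -/
theorem exists_left_L (hadd : ∀ γ δ : Gamma0 N, χ (γ * δ) = χ γ + χ δ)
    (hsmall : ∀ γ : Gamma0 N, ((γ : SL(2, ℤ)) 0 0 + (γ : SL(2, ℤ)) 1 1).natAbs ≤ 2 → χ γ = 0)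
    (γ : Gamma0 N) (t : ℤ) :
    ∃ γ' : Gamma0 N, (γ' : SL(2, ℤ)) 0 0 = (γ : SL(2, ℤ)) 0 0 ∧
      (γ' : SL(2, ℤ)) 1 0 = (γ : SL(2, ℤ)) 1 0 + t * N * (γ : SL(2, ℤ)) 0 0 ∧ χ γ' = χ γ := by
  obtain ⟨L, hL00, hL01, hL10, hL11⟩ :=
    ThetaLayerLambdaCongruenceAtTwo.exists_gamma0_entries (N := N) 1 0 ((N : ℤ) * t) 1 (by ring) (dvd_mul_right _ _)
  refine ⟨L * γ, ?_, ?_, ?_⟩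
  · rw [gamma0_mul_apply_zero_zero', hL00, hL01]; ring
  · rw [ThetaLayerLambdaCongruenceAtTwo.gamma0_mul_apply_one_zero, hL10, hL11]; ring
  · rw [hadd, hsmall L (by rw [hL00, hL11]; rfl), zero_add]

/-! ## §2. Under Artin, `χ` kills `Γ₁'(N)`; hence the node -/

/-- **Under `ArtinPrimitiveRootTwoAP`, at every odd level every additive `χ` killing the small-trace elements and the
`4^k`-classes kills `Γ₁'(N)`** (`d ≡ 1 (mod N)`): the first column `(a, c)` of `γ` has `N ∣ c`, `a ≡ 1 (mod N)`, `gcd(a, c) = 1`;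
by `CuspSpanArtin.exists_column_kill` the pre-moves `T^{i₀}`, `L_{t₀}`, `T^{i}` of §1 lead to a column killed by `chi_eq_zero_of_col_dvd_mul_four_pow`.
[cite: Moree2012ArtinSurvey, Thm. 1 (Lenstra) and Thm. 2] -/
theorem chi_eq_zero_of_mem_gamma1_of_artinAP (hA : ArtinPrimitiveRootTwoAP) (hN : ¬ 2 ∣ N)
    (hadd : ∀ γ δ : Gamma0 N, χ (γ * δ) = χ γ + χ δ)
    (hsmall : ∀ γ : Gamma0 N, ((γ : SL(2, ℤ)) 0 0 + (γ : SL(2, ℤ)) 1 1).natAbs ≤ 2 → χ γ = 0)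
    (hkill : ∀ γ : Gamma0 N, (∃ k : ℕ, 1 ≤ k ∧ ((γ : SL(2, ℤ)) 1 1).natAbs = 4 ^ k) → χ γ = 0)
    (γ : Gamma0 N) (hγ : γ ∈ Gamma1' N) : χ γ = 0 := by
  set a := (γ : SL(2, ℤ)) 0 0 with ha
  set c := (γ : SL(2, ℤ)) 1 0 with hc
  have hdet : a * (γ : SL(2, ℤ)) 1 1 - (γ : SL(2, ℤ)) 0 1 * c = 1 := by
    have := Matrix.SpecialLinearGroup.det_coe (γ : SL(2, ℤ))
    rwa [Matrix.det_fin_two] at this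
  have hcop : IsCoprime a c := ⟨(γ : SL(2, ℤ)) 1 1, -(γ : SL(2, ℤ)) 0 1, by linear_combination hdet⟩
  have hNc : (N : ℤ) ∣ c := by
    have h := γ.2
    rw [Gamma0_mem] at h
    exact (ZMod.intCast_zmod_eq_zero_iff_dvd _ N).mp h
  have hNa : (N : ℤ) ∣ a - 1 := by
    have hd : ((((γ : SL(2, ℤ)) 1 1 : ℤ) : ZMod N)) = 1 := by
      have h := hγ
      rw [Gamma1_mem'] at h
      exact h
    have hda := gamma0_apply_one_one_mul_apply_zero_zero γ
    rw [hd, one_mul] at hda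
    have : (((a - 1 : ℤ) : ZMod N)) = 0 := by push_cast; rw [hda, sub_self]
    exact (ZMod.intCast_zmod_eq_zero_iff_dvd _ N).mp this
  obtain ⟨i₀, t₀, i, t, k, hk, hdvd⟩ :=
    CuspSpanArtin.exists_column_kill hA (by omega) hNc hNa hcop
  obtain ⟨γ₁, h₁00, h₁10, hχ₁⟩ := exists_left_T hadd hsmall γ i₀
  obtain ⟨γ₂, h₂00, h₂10, hχ₂⟩ := exists_left_L hadd hsmall γ₁ t₀
  obtain ⟨γ₃, h₃00, h₃10, hχ₃⟩ := exists_left_T hadd hsmall γ₂ i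
  rw [← hχ₁, ← hχ₂, ← hχ₃]
  refine chi_eq_zero_of_col_dvd_mul_four_pow hadd hsmall hkill γ₃ t k hk ?_
  rw [h₃00, h₃10, h₂00, h₂10, h₁00, h₁10]
  exact hdvd

/-- **(G″)_N under Artin** at every odd level. [cite: Moree2012ArtinSurvey, Thm. 1 (Lenstra) and Thm. 2] [cite: Pollack2003, Conj. 6.3] -/
theorem cuspSpanTrace_of_artinAP [NeZero N] (hA : ArtinPrimitiveRootTwoAP) (hN : ¬ 2 ∣ N) :
    ∀ χ : Gamma0 N → ZMod 2,
      (∀ γ δ : Gamma0 N, χ (γ * δ) = χ γ + χ δ) →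
      (∀ γ : Gamma0 N, ((γ : SL(2, ℤ)) 0 0 + (γ : SL(2, ℤ)) 1 1).natAbs ≤ 2 → χ γ = 0) →
      (∀ γ : Gamma0 N, (∃ k : ℕ, 1 ≤ k ∧ ((γ : SL(2, ℤ)) 1 1).natAbs = 4 ^ k) → χ γ = 0) →
      ∃ ψ : ZMod N → ZMod 2, (∀ x y : ZMod N, IsUnit x → IsUnit y → ψ (x * y) = ψ x + ψ y) ∧
        ∀ γ : Gamma0 N, χ γ = ψ ((((γ : SL(2, ℤ)) 1 1 : ℤ) : ZMod N)) :=
  fun _ hadd hsmall hkill ↦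
    exists_mulChar_of_forall_gamma1 hadd fun γ hγ ↦ chi_eq_zero_of_mem_gamma1_of_artinAP hA hN hadd hsmall hkill γ hγ

/-- **THE NODE UNDER ARTIN.** Artin's primitive-root conjecture for the base `2` in the progressions `r mod m`, `8 ∣ m`,
`r ≡ 3 (mod 8)` (a theorem under GRH, Lenstra 1977) implies the curve-free node (G′)_N = `CuspSpanEvenAtTwo N` at EVERY odd
level `N`. [cite: Moree2012ArtinSurvey, Thm. 1 (Lenstra) and Thm. 2] [cite: Pollack2003, Conj. 6.3] -/
theorem cuspSpanEvenAtTwo_of_artinAP [NeZero N] (hA : ArtinPrimitiveRootTwoAP) (hN : ¬ 2 ∣ N) :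
    CuspSpanEvenAtTwo N :=
  cuspSpanEvenAtTwo_of_cuspSpanTrace (cuspSpanTrace_of_artinAP hA hN)

/-- **The class-wide node under Artin** — the hypothesis of `flatMuZeroAtTwo_of_forall_cuspSpanEvenAtTwo` /
`signedMuAnalyticAtTwoPlus_of_abbesUllmo_of_forall_cuspSpanEvenAtTwo`. [cite: Moree2012ArtinSurvey, Thm. 1 (Lenstra) and Thm. 2] -/
theorem forall_cuspSpanEvenAtTwo_of_artinAP (hA : ArtinPrimitiveRootTwoAP) :
    ∀ (N : ℕ) [NeZero N], ¬ 2 ∣ N → CuspSpanEvenAtTwo N :=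
  fun _ _ hN ↦ cuspSpanEvenAtTwo_of_artinAP hA hN

/-! ## §3. Closers by name under Artin (conditional; nothing is closed) -/

/-- **FLAT on the whole habitat⁺ under Artin**: granted `ArtinPrimitiveRootTwoAP` (a theorem under GRH), for every non-CM `W/ℚ` of
analytic rank `0`, good supersingular at `2` with `a₂ = 0` and `Δ_W < 0`, its newform `f` and every Pollack pair `(L♯, L♭)` at `2`:
`2 ∤ L♭` — the registered stub text `FlatMuZeroAtTwo` of crux Kμ⁺ (stmt-BirchSwinnertonDyer-20689), verbatim, under ONE classical
hypothesis. [cite: Moree2012ArtinSurvey, Thm. 1 (Lenstra) and Thm. 2] [cite: Pollack2003, Conj. 6.3 and Prop. 6.18] -/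
theorem flatMuZeroAtTwo_of_artinAP (hA : ArtinPrimitiveRootTwoAP) :
    ∀ (W : WeierstrassCurve ℚ) [W.IsElliptic] [W.IsGloballyMinimal], ¬ W.HasCM → W.analyticRank = 0 →
      GoodSS W 2 → W.frobeniusTrace 2 = 0 → W.Δ < 0 →
      ∀ [NeZero (W.conductorNorm ℤ)] (f : CuspForm (Gamma0 (W.conductorNorm ℤ)) 2), IsNewformOf W f →
      ∀ (Lplus Lminus : IwasawaAlgebra 2), IsPollackPair f 2 Lplus Lminus → ¬ PowerSeries.C (2 : ℤ_[2]) ∣ Lminus :=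
  flatMuZeroAtTwo_of_forall_cuspSpanEvenAtTwo (forall_cuspSpanEvenAtTwo_of_artinAP hA)

/-- **Item 21437 `SignedMuAnalyticAtTwoPlus` under Abbes–Ullmo Thm. A and Artin** (both by name; conditional — the item is not
closed by this). [cite: AbbesUllmo1996, Thm. A] [cite: Moree2012ArtinSurvey, Thm. 1 (Lenstra) and Thm. 2] -/
theorem signedMuAnalyticAtTwoPlus_of_abbesUllmo_of_artinAP
    (hAU : abbesUllmo_not_dvd_maninConstant_of_not_dvd_level) (hA : ArtinPrimitiveRootTwoAP) :
    SignedMuAnalyticAtTwoPlus :=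
  signedMuAnalyticAtTwoPlus_of_abbesUllmo_of_forall_cuspSpanEvenAtTwo hAU (forall_cuspSpanEvenAtTwo_of_artinAP hA)

/-- **The crux Kan⁺ `ThetaLayerLambdaCongruenceAtTwo` BY NAME under the seven print facts, Abbes–Ullmo and Artin** — the lead's twin
closer `kanP_of_pub_of_signedMuAnalyticAtTwoPlus` (PUB⁸ → 21437 → Kan⁺) fed with the previous theorem. CONDITIONAL (nine named
hypotheses, one of them conjecture-grade = GRH-grade); the crux item is NOT closed by this; BSD is not proved by this.
[cite: Moree2012ArtinSurvey, Thm. 1 (Lenstra) and Thm. 2] [cite: AbbesUllmo1996, Thm. A] [cite: Pollack2003, Conj. 6.3] -/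
theorem thetaLayerLambdaCongruenceAtTwo_of_pub_of_abbesUllmo_of_artinAP
    (hES : eichlerShimura_depletedOptimalQuotient_periodLattice_of_dvd)
    (hF : WeierstrassCurve.isIsogenous_iff_frobeniusTrace_eq) (hMK : mazurKenku_exists_cyclic_isogeny)
    (hSD : heckeSelfDual_torsionBy_J0) (hBz : buzzard2000_multiplicityOne_gamma0)
    (hSe : serre1972_supersingular_decompositionSubgroup_image)
    (hD : Deligne1974_heckeT_eigenvalue_norm_le)
    (hAU : abbesUllmo_not_dvd_maninConstant_of_not_dvd_level)
    (hA : ArtinPrimitiveRootTwoAP) :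
    ThetaLayerLambdaCongruenceAtTwo :=
  ThetaLayerLambdaCongruenceAtTwo.kanP_of_pub_of_signedMuAnalyticAtTwoPlus hES hF hMK hSD hBz hSe hD hAU
    (signedMuAnalyticAtTwoPlus_of_abbesUllmo_of_artinAP hAU hA)

end Summit.BirchSwinnertonDyer.BirchSwinnertonDyer.Theorems.SignedMuAtTwo

end
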